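import Literature.NumberTheory.Automorphic.ShimuraParametrizationSplitCaseConverseProofs
import HarnessLib

/-!
# (PAR) Periods of weight-two cusp forms vanish on parabolic elements — PROVED

Support file for crux `CartanOnePlaceDegreeLawAtThree` (NUM; item stmt-BirchSwinnertonDyer-24801, line `Lines/lattice`), Galois leaf (OBS) via the
inert-Hecke certificate: the clause «null on every parabolic element» of the certificate's output (EIG′)
`CartanCarayol.PeriodCharacterCuspidalEigenPackageAtThree` (bsd-idea-10 g20, p742701) rests on THIS analytic fact — for a subgroup `Γ ≤ GL₂(ℝ)`, a cusp form
`F : CuspForm Γ 2` (Mathlib: holomorphic and zero at every cusp `c` of `Γ`, `IsCusp c Γ` = «fixed point of a parabolic element of `Γ`») and a PARABOLIC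
`β ∈ Γ`, `∫_z^{βz} F = 0` for every `z ∈ ℍ` (the cocycle of a cusp form is parabolic, Shimura §8.2). PROOF (this file, sorry-free, Mathlib + the tree's period
calculus `segmentIntegral_slash_eq`, `segmentIntegral_eq_sub`, `exists_hasDerivAt_primitive`): `β` fixes `c = parabolicFixedPoint β`, a cusp; pick `g` with
`g • ∞ = c`, `det g > 0`; `β' = g⁻¹βg` is an upper-triangular parabolic of determinant `det β > 0` (a parabolic matrix has `tr² = 4 det`), so it acts on `ℍ` as a
real translation `w ↦ w + h`; `G = F ∣[2] g` is zero at `i∞` and `segmentIntegral G w (β'w)` is independent of `w` (primitive + `Γ'`-invariance of segment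
integrals for `translate F g`) and bounded by `ε·|h|` on the horizontal segment at height `≥ A(ε)`; hence it vanishes, and `∫_z^{βz} F = ∫_{g⁻¹z}^{β' g⁻¹ z} G = 0`.
THEOREMS ONLY. Nothing here is specific to a curve; BSD is proved for no curve.
-/

set_option linter.dupNamespace false
set_option autoImplicit false

noncomputable section

open scoped Classical MatrixGroups ModularForm Pointwise
open UpperHalfPlane ConjAct Filter

namespace Summit.BirchSwinnertonDyer.BirchSwinnertonDyer.Theorems.CartanCover.Charext.InertHecke

open Literature.NumberTheory.Automorphic

section Parabolic

variable {Γ : Subgroup (GL (Fin 2) ℝ)}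

/-- A parabolic element of `GL₂(ℝ)` has positive determinant (`tr² = 4·det`, `det ≠ 0`). [folklore] -/
theorem det_pos_of_isParabolic {β : GL (Fin 2) ℝ} (hβ : Matrix.GeneralLinearGroup.IsParabolic β) : 0 < β.det.val := by
  have h := hβ.2
  rw [Matrix.discr_fin_two] at h
  have hdet : (β : Matrix (Fin 2) (Fin 2) ℝ).det = (β : Matrix (Fin 2) (Fin 2) ℝ).trace ^ 2 / 4 := by linarith
  rw [Matrix.GeneralLinearGroup.val_det_apply, hdet]
  have hne : (β : Matrix (Fin 2) (Fin 2) ℝ).trace ≠ 0 := by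
    intro h0
    apply β.det_ne_zero
    rw [hdet, h0]; norm_num
  positivity

/-- Every point of `OnePoint ℝ` is `g • ∞` for some `g ∈ GL₂(ℝ)` of determinant `1`. [folklore] -/
theorem exists_smul_infty_eq (c : OnePoint ℝ) : ∃ g : GL (Fin 2) ℝ, 0 < g.det.val ∧ g • (OnePoint.infty : OnePoint ℝ) = c := by
  cases c with
  | infty => exact ⟨1, by simp, by simp⟩
  | coe x =>
    refine ⟨Matrix.GeneralLinearGroup.mkOfDetNeZero !![x, -1; 1, 0] (by simp [Matrix.det_fin_two]), ?_, ?_⟩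
    · rw [Matrix.GeneralLinearGroup.val_det_apply]
      simp [Matrix.det_fin_two]
    · rw [OnePoint.smul_infty_eq_ite]
      simp

/-- An upper-triangular element with equal diagonal entries acts on `ℍ` as a real translation. [folklore] -/
theorem coe_smul_of_upperTriangular {β : GL (Fin 2) ℝ} (h10 : β 1 0 = 0) (hdiag : β 0 0 = β 1 1) (hdet : 0 < β.det.val) (w : ℍ) :
    ((β • w : ℍ) : ℂ) = (w : ℂ) + ((β 0 1 / β 1 1 : ℝ) : ℂ) := by
  have ha : β 1 1 ≠ 0 := by
    intro h0
    apply β.det_ne_zero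
    rw [Matrix.det_fin_two]
    simp [h10, h0]
  have ha' : ((β 1 1 : ℝ) : ℂ) ≠ 0 := by exact_mod_cast ha
  rw [coe_smul_of_det_pos hdet, num, denom, h10, hdiag]
  push_cast
  rw [zero_mul, zero_add, add_div, mul_div_cancel_left₀ _ ha']

/-- **(PAR) PERIODS OF WEIGHT-TWO CUSP FORMS VANISH ON PARABOLIC ELEMENTS.** For `F : CuspForm Γ 2` and a parabolic `β ∈ Γ`:
`segmentIntegral F z (β • z) = 0` for every `z ∈ ℍ`. [cite: ShimuraIATAF1971, §8.2 (parabolic cocycles) and Thm. 8.4] -/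
theorem segmentIntegral_eq_zero_of_isParabolic (F : CuspForm Γ 2) {β : GL (Fin 2) ℝ} (hβΓ : β ∈ Γ)
    (hβ : Matrix.GeneralLinearGroup.IsParabolic β) (z : ℍ) : segmentIntegral (⇑F) z (β • z) = 0 := by
  -- the cusp fixed by `β` and a frame `g • ∞ = c`
  set c : OnePoint ℝ := Matrix.GeneralLinearGroup.parabolicFixedPoint β with hc
  have hβc : β • c = c := hβ.smul_eq_self_iff.mpr rfl
  have hcusp : IsCusp c Γ := ⟨β, hβΓ, hβ, hβc⟩
  obtain ⟨g, hgdet, hginf⟩ := exists_smul_infty_eq c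
  -- `β' = g⁻¹ β g` fixes `∞`: upper triangular, parabolic, positive determinant
  set β' : GL (Fin 2) ℝ := g⁻¹ * β * g with hβ'
  have hβ'inf : β' • (OnePoint.infty : OnePoint ℝ) = OnePoint.infty := by
    rw [hβ', mul_smul, mul_smul, hginf, hβc, ← hginf, inv_smul_smul]
  have h10 : β' 1 0 = 0 := OnePoint.smul_infty_eq_self_iff.mp hβ'inf
  have hβ'par : Matrix.GeneralLinearGroup.IsParabolic β' := by
    rw [hβ']; exact (Matrix.GeneralLinearGroup.isParabolic_conj_iff' g β).mpr hβ
  have hβ'det : 0 < β'.det.val := det_pos_of_isParabolic hβ'par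
  obtain ⟨hdiag, -⟩ := (Matrix.GeneralLinearGroup.isParabolic_iff_of_upperTriangular h10).mp hβ'par
  set h : ℝ := β' 0 1 / β' 1 1 with hh
  have htrans : ∀ w : ℍ, ((β' • w : ℍ) : ℂ) = (w : ℂ) + (h : ℂ) := fun w => coe_smul_of_upperTriangular h10 hdiag hβ'det w
  -- `β' ∈ g⁻¹ Γ g`, the level of `translate F g`
  have hβ'mem : β' ∈ toConjAct g⁻¹ • Γ := by
    rw [map_inv, Subgroup.mem_inv_pointwise_smul_iff, toConjAct_smul, hβ']
    simpa [mul_assoc] using hβΓ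
  -- `G = F ∣[2] g` as a cusp form on `g⁻¹ Γ g`; it is zero at `i∞`
  set G : CuspForm (toConjAct g⁻¹ • Γ) 2 := CuspForm.translate F g with hG
  have hGcoe : (⇑G : ℍ → ℂ) = ⇑F ∣[(2 : ℤ)] g := rfl
  have hzero : IsZeroAtImInfty (⇑G) := by
    rw [hGcoe]
    exact CuspFormClass.zero_at_cusps F hcusp g hginf
  -- the period of `G` over `β'`: `I w = ∫_w^{β' w} G`, independent of `w`
  obtain ⟨P, hP⟩ := exists_hasDerivAt_primitive G
  have hI : ∀ w w' : ℍ, segmentIntegral (⇑G) w (β' • w) = segmentIntegral (⇑G) w' (β' • w') := by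
    intro w w'
    have hinv : segmentIntegral (⇑G) (β' • w') (β' • w) = segmentIntegral (⇑G) w' w := by
      rw [← segmentIntegral_slash_eq G hβ'det w' w]
      congr 1
      exact SlashInvariantForm.slash_action_eqn G β' hβ'mem
    rw [segmentIntegral_eq_sub G hP, segmentIntegral_eq_sub G hP] at hinv ⊢
    linear_combination hinv
  -- `∫_z^{βz} F = I (g⁻¹ z)`
  have hper : segmentIntegral (⇑F) z (β • z) = segmentIntegral (⇑G) (g⁻¹ • z) (β' • g⁻¹ • z) := by
    rw [hGcoe, segmentIntegral_slash_eq F hgdet, smul_inv_smul, hβ']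
    congr 1
    rw [mul_smul, mul_smul, smul_inv_smul, smul_inv_smul]
  rw [hper]
  -- the bound `‖I w‖ ≤ ε |h|` at height `≥ A(ε)`
  rw [← norm_eq_zero]
  refine le_antisymm (le_of_forall_pos_le_add fun ε hε => ?_) (norm_nonneg _)
  rw [zero_add]
  obtain ⟨A, hA⟩ := isZeroAtImInfty_iff.mp hzero (ε / (|h| + 1)) (by positivity)
  -- a point at height `max A 1`
  set y : ℝ := max A 1 with hy
  have hy0 : 0 < y := lt_of_lt_of_le one_pos (le_max_right _ _)
  let w : ℍ := ⟨Complex.I * y, by simpa using hy0⟩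
  have hwim : w.im = y := by simp [w, UpperHalfPlane.im]
  rw [hI (g⁻¹ • z) w]
  -- the integrand along the horizontal segment
  have hseg : ∀ t : ℝ, (1 - (t : ℂ)) * (w : ℂ) + (t : ℂ) * ((β' • w : ℍ) : ℂ) = (w : ℂ) + t * h := by
    intro t; rw [htrans]; ring
  have him : ∀ t : ℝ, ((w : ℂ) + t * h).im = y := by
    intro t
    simp [w, Complex.add_im, Complex.mul_im]
  have hbound : ∀ t ∈ Set.uIoc (0 : ℝ) 1,
      ‖G (ofComplex ((1 - (t : ℂ)) * (w : ℂ) + (t : ℂ) * ((β' • w : ℍ) : ℂ))) * (((β' • w : ℍ) : ℂ) - (w : ℂ))‖ ≤ ε / (|h| + 1) * |h| := by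
    intro t _
    rw [hseg, htrans, add_sub_cancel_left, norm_mul, Complex.norm_real, Real.norm_eq_abs]
    refine mul_le_mul_of_nonneg_right ?_ (abs_nonneg h)
    apply hA
    have hpos : 0 < ((w : ℂ) + t * h).im := by rw [him]; exact hy0
    rw [← UpperHalfPlane.coe_im, ofComplex_apply_of_im_pos hpos]
    change A ≤ ((w : ℂ) + t * h).im
    rw [him]
    exact le_max_left _ _
  have hint := intervalIntegral.norm_integral_le_of_norm_le_const hbound
  rw [segmentIntegral]
  refine hint.trans ?_
  rw [sub_zero, abs_one, mul_one]
  have h1 : ε / (|h| + 1) * |h| ≤ ε := by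
    rw [div_mul_eq_mul_div, div_le_iff₀ (by positivity)]
    nlinarith [abs_nonneg h]
  exact h1

end Parabolic

end Summit.BirchSwinnertonDyer.BirchSwinnertonDyer.Theorems.CartanCover.Charext.InertHecke

end
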